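import Summits.QuantumFields.YangMills.Theorems.BalabanLadderNTConditionalPackageCollar
import HarnessLib

/-!
# Crux `NT` (stmt-QuantumFields-19353), stub `stub_cfpw : CFPW`: the weak clauses (F), (T) with an antitone collar

Helper file (`--supports stmt-QuantumFields-19353`) of the fleet lead prover of crux `NT` (unit `ym-spine-19353-p1`,
g2); the weak-package edition of the sibling `…NTConditionalPackageCollar` (g0: `fc2_of_antitoneCollar`,
`fc3_of_antitoneCollar`).  The weak floor clause (F) and the weak third-cumulant clause (T) of the registered skeleton v3
«weak-package» (374f16092bb0c203; texts in `Theorems/BalabanLadderNTWeakPackage.lean`) keep the registry's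
scale-indexed collar device: the bound is required whenever `K(s₀) · ‖y−x‖ ≤ depth` for SOME physical scale
`0 < s₀ ≤ ‖y−x‖ · a β`.  For the PRODUCER this is an extra universally quantified real; an engine's collar
`K(s) ≍ g(s)^{-1/2}` is antitone, and then the weakest instance is `s₀ = ‖y−x‖ · a β` itself
(`ConditionalPackage.collar_le_of_antitone`).  Hence:

* `floorClause_of_antitoneCollar` — (F) follows from its variant with `AntitoneOn K (Set.Ioi 0)` and the SINGLE depth
  condition `K (‖y−x‖ · a β) · ‖y−x‖ ≤ depth y` (same witnesses);
* `fc3Weak_of_antitoneCollar` — (T) follows from its variant with `AntitoneOn K₃ (Set.Ioi 0)` and the single condition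
  `K₃ (n · a β) · n ≤ depth` at `x, y, z`.
-/

set_option autoImplicit false

noncomputable section

open MeasureTheory Filter Topology
open Literature.MathematicalPhysics.QuantumFieldTheory Literature.MathematicalPhysics.QuantumLattice
open Literature.Probability.LatticeModels
open Summit.QuantumFields.YangMills.Cruxes.OSLegsFromFemtoAndGap.DlrCollarTransfer
open Summit.QuantumFields.YangMills.Cruxes.NT.ConditionalPackage (collar_le_of_antitone)

namespace Summit.QuantumFields.YangMills.Cruxes.NT.WeakPackage

section Lattice

variable (G : Type) [Group G] [TopologicalSpace G] [IsTopologicalGroup G] [CompactSpace G]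
  [MeasurableSpace G] [BorelSpace G] (r : LatticeRep G) (a : ℝ → ℝ)

/-- **The weak floor clause (F) from a single antitone collar condition.** [folklore] -/
theorem floorClause_of_antitoneCollar
    (h : ∃ (Γ : ℝ → ℝ) (β₂ ℓ₂ c₂ : ℝ) (K : ℝ → ℝ) (n₀ : ℕ), 0 < ℓ₂ ∧ 0 < c₂ ∧ (∀ s, 1 ≤ K s) ∧
      AntitoneOn K (Set.Ioi 0) ∧ Tendsto (fun s : ℝ => s * K s) (nhdsWithin 0 (Set.Ioi 0)) (nhds 0) ∧ 1 ≤ n₀ ∧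
      Tendsto (fun s : ℝ => Γ s / s ^ 8) (nhdsWithin 0 (Set.Ioi 0)) atTop ∧
      ∀ β : ℝ, β₂ ≤ β → ∀ (x : Fin 4 → ℤ) (R : ℕ), ((2 * R + 1 : ℕ) : ℝ) * a β ≤ ℓ₂ →
        ∀ (η : LGConfig 4 G) (y : Fin 4 → ℤ), 0 < ‖siteToE (y - x)‖ * a β →
          (n₀ : ℝ) ≤ ‖siteToE (y - x)‖ → ‖siteToE (y - x)‖ < 3 * siteToE (y - x) 0 →
            K (‖siteToE (y - x)‖ * a β) * ‖siteToE (y - x)‖ ≤ depth (fun j => x j - R) (2 * R + 1) y →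
              c₂ * Γ (‖siteToE (y - x)‖ * a β) ≤
                ‖siteToE (y - x)‖ ^ 8 *
                  kerCov G r β (fun j => x j - R) (2 * R + 1) η (dens G r x) (dens G r y)) :
    ∃ (Γ : ℝ → ℝ) (β₂ ℓ₂ c₂ : ℝ) (K : ℝ → ℝ) (n₀ : ℕ), 0 < ℓ₂ ∧ 0 < c₂ ∧ (∀ s, 1 ≤ K s) ∧
      Tendsto (fun s : ℝ => s * K s) (nhdsWithin 0 (Set.Ioi 0)) (nhds 0) ∧ 1 ≤ n₀ ∧
      Tendsto (fun s : ℝ => Γ s / s ^ 8) (nhdsWithin 0 (Set.Ioi 0)) atTop ∧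
      ∀ β : ℝ, β₂ ≤ β → ∀ (x : Fin 4 → ℤ) (R : ℕ), ((2 * R + 1 : ℕ) : ℝ) * a β ≤ ℓ₂ →
        ∀ (η : LGConfig 4 G) (y : Fin 4 → ℤ) (s₀ : ℝ), 0 < s₀ → s₀ ≤ ‖siteToE (y - x)‖ * a β →
          (n₀ : ℝ) ≤ ‖siteToE (y - x)‖ → ‖siteToE (y - x)‖ < 3 * siteToE (y - x) 0 →
            K s₀ * ‖siteToE (y - x)‖ ≤ depth (fun j => x j - R) (2 * R + 1) y →
              c₂ * Γ (‖siteToE (y - x)‖ * a β) ≤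
                ‖siteToE (y - x)‖ ^ 8 *
                  kerCov G r β (fun j => x j - R) (2 * R + 1) η (dens G r x) (dens G r y) := by
  obtain ⟨Γ, β₂, ℓ₂, c₂, K, n₀, hℓ₂, hc₂, hK1, hKanti, hKlim, hn₀, hΓlim, H⟩ := h
  refine ⟨Γ, β₂, ℓ₂, c₂, K, n₀, hℓ₂, hc₂, hK1, hKlim, hn₀, hΓlim, ?_⟩
  intro β hβ x R hb η y s₀ hs₀ hs₀le hn hcone hKy
  exact H β hβ x R hb η y (hs₀.trans_le hs₀le) hn hcone
    (collar_le_of_antitone hKanti hs₀ hs₀le (norm_nonneg _) hKy)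

/-- **The weak third-cumulant clause (T) from a single antitone collar condition.** [folklore] -/
theorem fc3Weak_of_antitoneCollar
    (h : ∃ (v w : EuclideanSpace ℝ (Fin 4)) (σ δ : ℝ) (Γ₃ : ℝ → ℝ) (β₃ ℓ₃ c₃ : ℝ) (K₃ : ℝ → ℝ) (n₃ : ℕ),
      (σ = 1 ∨ σ = -1) ∧ 0 < δ ∧ 2 * δ < ‖v‖ ∧ 2 * δ < ‖w‖ ∧ 2 * δ < ‖v - w‖ ∧ 0 < ℓ₃ ∧ 0 < c₃ ∧
      (∀ s, 1 ≤ K₃ s) ∧ AntitoneOn K₃ (Set.Ioi 0) ∧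
      Tendsto (fun s : ℝ => s * K₃ s) (nhdsWithin 0 (Set.Ioi 0)) (nhds 0) ∧
      Tendsto (fun s : ℝ => Γ₃ s / s ^ 4) (nhdsWithin 0 (Set.Ioi 0)) atTop ∧
      ∀ β : ℝ, β₃ ≤ β → ∀ (x : Fin 4 → ℤ) (R : ℕ), ((2 * R + 1 : ℕ) : ℝ) * a β ≤ ℓ₃ →
        ∀ (η : LGConfig 4 G) (n : ℕ) (y z : Fin 4 → ℤ), 0 < (n : ℝ) * a β →
          n₃ ≤ n → ‖siteToE (y - x) - (n : ℝ) • v‖ ≤ δ * n → ‖siteToE (z - x) - (n : ℝ) • w‖ ≤ δ * n →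
            K₃ ((n : ℝ) * a β) * n ≤ depth (fun j => x j - R) (2 * R + 1) x →
            K₃ ((n : ℝ) * a β) * n ≤ depth (fun j => x j - R) (2 * R + 1) y →
            K₃ ((n : ℝ) * a β) * n ≤ depth (fun j => x j - R) (2 * R + 1) z →
              c₃ * Γ₃ ((n : ℝ) * a β) ≤
                σ * (n : ℝ) ^ 12 * kerK3 G r β (fun j => x j - R) (2 * R + 1) η x y z) :
    ∃ (v w : EuclideanSpace ℝ (Fin 4)) (σ δ : ℝ) (Γ₃ : ℝ → ℝ) (β₃ ℓ₃ c₃ : ℝ) (K₃ : ℝ → ℝ) (n₃ : ℕ),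
      (σ = 1 ∨ σ = -1) ∧ 0 < δ ∧ 2 * δ < ‖v‖ ∧ 2 * δ < ‖w‖ ∧ 2 * δ < ‖v - w‖ ∧ 0 < ℓ₃ ∧ 0 < c₃ ∧
      (∀ s, 1 ≤ K₃ s) ∧ Tendsto (fun s : ℝ => s * K₃ s) (nhdsWithin 0 (Set.Ioi 0)) (nhds 0) ∧
      Tendsto (fun s : ℝ => Γ₃ s / s ^ 4) (nhdsWithin 0 (Set.Ioi 0)) atTop ∧
      ∀ β : ℝ, β₃ ≤ β → ∀ (x : Fin 4 → ℤ) (R : ℕ), ((2 * R + 1 : ℕ) : ℝ) * a β ≤ ℓ₃ →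
        ∀ (η : LGConfig 4 G) (n : ℕ) (y z : Fin 4 → ℤ) (s₀ : ℝ), 0 < s₀ → s₀ ≤ (n : ℝ) * a β →
          n₃ ≤ n → ‖siteToE (y - x) - (n : ℝ) • v‖ ≤ δ * n → ‖siteToE (z - x) - (n : ℝ) • w‖ ≤ δ * n →
            K₃ s₀ * n ≤ depth (fun j => x j - R) (2 * R + 1) x →
            K₃ s₀ * n ≤ depth (fun j => x j - R) (2 * R + 1) y →
            K₃ s₀ * n ≤ depth (fun j => x j - R) (2 * R + 1) z →
              c₃ * Γ₃ ((n : ℝ) * a β) ≤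
                σ * (n : ℝ) ^ 12 * kerK3 G r β (fun j => x j - R) (2 * R + 1) η x y z := by
  obtain ⟨v, w, σ, δ, Γ₃, β₃, ℓ₃, c₃, K₃, n₃, hσ, hδ, hv, hw, hvw, hℓ₃, hc₃, hK1, hKanti, hKlim, hΓlim, H⟩ := h
  refine ⟨v, w, σ, δ, Γ₃, β₃, ℓ₃, c₃, K₃, n₃, hσ, hδ, hv, hw, hvw, hℓ₃, hc₃, hK1, hKlim, hΓlim, ?_⟩
  intro β hβ x R hb η n y z s₀ hs₀ hs₀le hn hy hz hKx hKy hKz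
  have hν : 0 ≤ (n : ℝ) := Nat.cast_nonneg n
  exact H β hβ x R hb η n y z (hs₀.trans_le hs₀le) hn hy hz (collar_le_of_antitone hKanti hs₀ hs₀le hν hKx)
    (collar_le_of_antitone hKanti hs₀ hs₀le hν hKy) (collar_le_of_antitone hKanti hs₀ hs₀le hν hKz)

end Lattice

end Summit.QuantumFields.YangMills.Cruxes.NT.WeakPackage

end
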